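/-
Copyright (c) 2026 the pub-hodgecm-mathlib formalisation cell (harness21).  Prover seat hodgecm-mathlib-LD1-p02 (g4), FLOOR 0, programme P6,
half-A line LD1 of crux `hLiu418`, brick (Gα-C∞) `ArchLadder`, plate (P4) «ι-step», transport layer of (P4b)∕(P4c).  KERNEL module: THEOREMS ONLY
(no definition, no named fact, no `sorry`, no instance, no notation).
-/
import Literature.NumberTheory.Weil1964.ArchUnitaryWeilHalfCompact
import Literature.RepresentationTheory.KonnoKonno2007.JunctionHyperbolicHermiteLadder
import Literature.RepresentationTheory.KonnoKonno2007.JunctionSwapBargmann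
import HarnessLib

/-!
# Relabelling the coordinates: Folland's `μ₀`, the Levi dilations, the Hermite functions ∕ coefficients and the hyperbolic family
# `hypOp` transported along an index bijection `ε : σ ≃ σ′`

Topic `RepresentationTheory/KonnoKonno2007`; namespaces `Literature.RepresentationTheory.KonnoKonno2007` (§1–§2, generic) and
`Literature.RepresentationTheory.KonnoKonno2007.RealDualPair` (§3).  KERNEL ONLY: proved theorems about tree definitions; 0 definitions, 0 records,
0 `sorry`.

For an index bijection `ε : σ ≃ σ′` the tree transports Schwartz functions by `e_* = schwartzTransport (reindexCLE ε) : 𝓢(ℝ^{σ′}) ≃ 𝓢(ℝ^σ)`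
(★ `ArchWeilDatumReindex`, ★ `ArchMetaplecticReindex`).  This file records how the building blocks of the Schrödinger–Fock model move under `e_*`:

* §1 **`schwartzTransport_reindexCLE_unitaryOpPi`**: `e_* ∘ μ₀(U) = μ₀(U^ε) ∘ e_*` (`U^ε = reindexUnitary ε U`; Schur in `Mp^𝓢`: both sides lie over
  `realify U^ε` — ★ `reindexSp_realifySp` — with vacuum coefficient `1`); **`schwartzTransport_reindexCLE_leviS`**: `e_* ∘ leviS L = leviS L^ε ∘ e_*`
  (`L^ε = reindexLin ε L`, pointwise; `|det L^ε| = |det L|`); `reindexLin_diagEquiv` (a relabelled diagonal dilation is diagonal);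
* §2 **`schwartzTransport_reindexCLE_hermitePi`** ∕ `_symm_hermitePi`: `e_* h_β = h_{β ∘ ε}`; **`piCoeff_schwartzTransport_reindexCLE`**:
  `c_γ(e_* F) = c_{γ ∘ ε⁻¹}(F)` (the `L²`-pairing with `h_γ` and the permutation unitary ★ `l2Reindex`);
* §3 **`schwartzTransport_reindexCLE_hypOp`**: the hyperbolic family of the junction `U(P,Q) × U(R,S)` transported to `𝓢(ℝ^σ)` along
  `ε : σ ≃ DPIdx P Q R S` IS `μ₀((u^ε))⁻¹ ∘ leviS (δ_{eᵗ}^ε) ∘ μ₀(u^ε)` (`u = frameU`, `δ = planeDil`); and the transported LADDER of ★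
  `JunctionHyperbolicHermiteLadder` (rank-one definite `W`): **`exists_piCoeff_add_reindex_hypOp_hermitePi_ne_zero`** ∕ `…_sub_…` — for every `β : σ →₀ ℕ`
  SOME boost moves `h_β` onto `h_{β ± (e_k + e_{k′})}`, `k = ε⁻¹(p₀)`, `k′ = ε⁻¹(q₀)`, with non-zero Hermite coefficient.

These are the index-bookkeeping inputs of the «ι-step» of brick (Gα-C∞) `ArchLadder` (line LD1 of crux `hLiu418`, cell hodgecm-mathlib): the doubled
archimedean section is read on `𝓢(ℝ^{Fin (n+n) × places})` through ★ `archIdx`, the undoubled one on `𝓢(ℝ^{Fin n × places})`.  Nothing of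
[Liu2021] is asserted; HC_CM is NOT proved here or anywhere in the tree.

## References
* [Folland1989] G. B. Folland, *Harmonic Analysis in Phase Space*, Princeton UP 1989, §1.3 (1.25), §1.7 (1.81)–(1.82), §4.2 (4.24), Prop. (4.39).
* [Weil1964] A. Weil, Acta Math. 111 (1964), Chap. I n° 12 p. 160 (the standard representation depends only on the symplectic structure).
* [KonnoKonno2007] K. Konno, T. Konno, Kyushu J. Math. 61 (2007), §3.1 (3.1) (junction conventions only).
-/

set_option autoImplicit false

noncomputable section

open Matrix Complex MeasureTheory SchwartzMap
open scoped InnerProductSpace ComplexConjugate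

namespace Literature.RepresentationTheory.KonnoKonno2007

open Literature.Analysis.SegalBargmann Literature.RepresentationTheory.HeisenbergGroup
open Literature.NumberTheory.Weil1964 Literature.NumberTheory.Weil1964.MpS

/-! ## §1 `μ₀`, the Levi dilations and the diagonal dilations under relabelling -/

section Generic

variable {σ σ' : Type} [Fintype σ] [DecidableEq σ] [Fintype σ'] [DecidableEq σ']

/-- **`e_* ∘ μ₀(U) = μ₀(U^ε) ∘ e_*`**: Folland's metaplectic operator of a unitary, transported along a relabelling of the coordinates, is the
operator of the relabelled unitary (both lie over `realify U^ε` in `Mp^𝓢` with vacuum coefficient `1`; Schur). [cite: Folland1989, §4.2 Prop. (4.39), §1.3 (1.25)] -/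
theorem schwartzTransport_reindexCLE_unitaryOpPi (ε : σ ≃ σ') (U : Matrix.unitaryGroup σ' ℂ) (f : SchwartzMap (σ' → ℝ) ℂ) :
    schwartzTransport (reindexCLE ε) (unitaryOpPi U f) = unitaryOpPi (reindexUnitary ε U) (schwartzTransport (reindexCLE ε) f) := by
  have h : MpS.reindex ε (MpS.unitary U) = MpS.unitary (reindexUnitary ε U) := by
    refine MpS.eq_of_proj_eq_of_vac_eq ?_ ?_ ?_
    · show reindexSp ε (proj (MpS.unitary U)) = proj (MpS.unitary (reindexUnitary ε U))
      rw [proj_unitary, proj_unitary, reindexSp_realifySp]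
    · rw [vac_reindex, vac_unitary, vac_unitary]
    · rw [vac_reindex, vac_unitary]
      exact one_ne_zero
  have h2 := MpS.reindex_apply_schwartzTransport ε (MpS.unitary U) f
  rw [h] at h2
  have hu : ∀ (τ : Type) [Fintype τ] [DecidableEq τ] (u : Matrix.unitaryGroup τ ℂ) (g : SchwartzMap (τ → ℝ) ℂ),
      (MpS.unitary u).1.2 g = unitaryOpPi u g := fun τ _ _ u g => by
    show unitaryEquivPi u g = unitaryOpPi u g
    rw [unitaryEquivPi_apply]
  rw [hu, hu] at h2
  exact h2.symm

omit [Fintype σ] [DecidableEq σ] [Fintype σ'] [DecidableEq σ'] in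
/-- `|det L^ε|^{-1/2} = |det L|^{-1/2}` (conjugate linear maps have the same determinant). [cite: Folland1989, §4.2 (4.24)] -/
theorem leviFactor_reindexLin (ε : σ ≃ σ') (L : (σ' → ℝ) ≃ₗ[ℝ] (σ' → ℝ)) : leviFactor (reindexLin ε L) = leviFactor L := by
  have h : ((reindexLin ε L : (σ → ℝ) ≃ₗ[ℝ] (σ → ℝ)) : (σ → ℝ) →ₗ[ℝ] (σ → ℝ)) =
      ((LinearEquiv.funCongrLeft ℝ ℝ ε : (σ' → ℝ) ≃ₗ[ℝ] (σ → ℝ)) : (σ' → ℝ) →ₗ[ℝ] (σ → ℝ)) ∘ₗ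
        ((L : (σ' → ℝ) ≃ₗ[ℝ] (σ' → ℝ)) : (σ' → ℝ) →ₗ[ℝ] (σ' → ℝ)) ∘ₗ
          (((LinearEquiv.funCongrLeft ℝ ℝ ε).symm : (σ → ℝ) ≃ₗ[ℝ] (σ' → ℝ)) : (σ → ℝ) →ₗ[ℝ] (σ' → ℝ)) := by
    refine LinearMap.ext fun x => ?_
    rfl
  rw [leviFactor, leviFactor, h, LinearMap.det_conj]

omit [DecidableEq σ] [DecidableEq σ'] in
/-- **`e_* ∘ leviS L = leviS L^ε ∘ e_*`**: the Levi dilation transported along a relabelling is the dilation by the relabelled linear map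
(pointwise). [cite: Folland1989, §4.2 (4.24), §1.3 (1.25)] -/
theorem schwartzTransport_reindexCLE_leviS (ε : σ ≃ σ') (L : (σ' → ℝ) ≃ₗ[ℝ] (σ' → ℝ)) (f : SchwartzMap (σ' → ℝ) ℂ) :
    schwartzTransport (reindexCLE ε) (leviS L f) = leviS (reindexLin ε L) (schwartzTransport (reindexCLE ε) f) := by
  ext x
  rw [schwartzTransport_apply, leviS_apply, leviS_apply, schwartzTransport_apply, leviFactor_reindexLin, reindexLin_symm]
  congr 2
  funext j
  rw [reindexCLE_symm_apply, reindexLin_apply, Function.comp_apply, Equiv.apply_symm_apply]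
  rfl

omit [Fintype σ] [DecidableEq σ] [Fintype σ'] [DecidableEq σ'] in
/-- a relabelled diagonal dilation is the diagonal dilation with relabelled weights. [cite: Folland1989, §4.2 (4.24)] -/
theorem reindexLin_diagEquiv (ε : σ ≃ σ') (c : σ' → ℝ) (hc : ∀ k, c k ≠ 0) :
    reindexLin ε (RealDualPair.diagEquiv c hc) = RealDualPair.diagEquiv (c ∘ ε) (fun k => hc (ε k)) := by
  refine LinearEquiv.ext fun x => funext fun k => ?_
  simp only [reindexLin_apply, Function.comp_apply, RealDualPair.diagEquiv_apply, Equiv.symm_apply_apply]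

/-! ## §2 Hermite functions and Hermite coefficients under relabelling -/

/-- **`e_* h_β = h_{β ∘ ε}`** (`reindexCLE ε = relabelCLE ε⁻¹`; ★ `schwartzTransport_relabelCLE_hermitePi`). [cite: Folland1989, §1.7 (1.81)] -/
theorem schwartzTransport_reindexCLE_hermitePi (ε : σ ≃ σ') (β : σ' →₀ ℕ) :
    schwartzTransport (reindexCLE ε) (hermitePi β) = hermitePi (β.equivMapDomain ε.symm) :=
  schwartzTransport_relabelCLE_hermitePi ε.symm β

/-- **`e_*⁻¹ h_γ = h_{γ ∘ ε⁻¹}`**. [cite: Folland1989, §1.7 (1.81)] -/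
theorem schwartzTransport_reindexCLE_symm_hermitePi (ε : σ ≃ σ') (γ : σ →₀ ℕ) :
    (schwartzTransport (reindexCLE ε)).symm (hermitePi γ) = hermitePi (γ.equivMapDomain ε) := by
  apply (schwartzTransport (reindexCLE ε)).injective
  rw [ContinuousLinearEquiv.apply_symm_apply, schwartzTransport_reindexCLE_hermitePi, ← Finsupp.equivMapDomain_trans,
    Equiv.self_trans_symm, Finsupp.equivMapDomain_refl]

/-- **`c_γ(e_* F) = c_{γ ∘ ε⁻¹}(F)`**: the Hermite coefficients of a relabelled function (`c_γ = ⟪h_γ, ·⟫_{L²}`, the permutation unitary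
★ `l2Reindex`). [cite: Folland1989, §1.7 (1.81), §1.3 (1.25)] -/
theorem piCoeff_schwartzTransport_reindexCLE (ε : σ ≃ σ') (γ : σ →₀ ℕ) (F : SchwartzMap (σ' → ℝ) ℂ) :
    piCoeff γ (schwartzTransport (reindexCLE ε) F) = piCoeff (γ.equivMapDomain ε) F := by
  rw [← piCoeffCLM_apply, ← piCoeffCLM_apply, piCoeffCLM_eq_inner, piCoeffCLM_eq_inner, ← toL2_hermitePi, ← toL2_hermitePi,
    toL2_schwartzTransport_reindexCLE, ← schwartzTransport_reindexCLE_symm_hermitePi ε γ]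
  conv_lhs => rw [← (schwartzTransport (reindexCLE ε)).apply_symm_apply (hermitePi γ), toL2_schwartzTransport_reindexCLE]
  rw [LinearIsometryEquiv.inner_map_map]

end Generic

/-! ## §3 The hyperbolic family of a junction, transported to any relabelling of its coordinates -/

namespace RealDualPair

section Hyp

variable {σ : Type} [Fintype σ] [DecidableEq σ] {P Q : Type} (R S : Type) [Fintype P] [DecidableEq P] [Fintype Q] [DecidableEq Q]
  [Fintype R] [DecidableEq R] [Fintype S] [DecidableEq S] (p₀ : P) (q₀ : Q)

/-- **THE TRANSPORTED HYPERBOLIC FAMILY**: along `ε : σ ≃ DPIdx P Q R S`,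
`e_* ∘ hypOp t = μ₀((u^ε)⁻¹) ∘ leviS (δ_{eᵗ}^ε) ∘ μ₀(u^ε) ∘ e_*` (`u = frameU`, `δ_c = planeDil c`; §1). [cite: Folland1989, §4.2 (4.24), Prop. (4.39)] -/
theorem schwartzTransport_reindexCLE_hypOp (ε : σ ≃ DPIdx P Q R S) (t : ℝ) (f : SchwartzMap (DPIdx P Q R S → ℝ) ℂ) :
    schwartzTransport (reindexCLE ε) (hypOp R S p₀ q₀ t f) =
      unitaryOpPi (reindexUnitary ε (frameU R S p₀ q₀))⁻¹
        (leviS (reindexLin ε (planeDil R S p₀ q₀ (Real.exp t) (Real.exp_pos t).ne'))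
          (unitaryOpPi (reindexUnitary ε (frameU R S p₀ q₀)) (schwartzTransport (reindexCLE ε) f))) := by
  rw [hypOp_apply, schwartzTransport_reindexCLE_unitaryOpPi, map_inv, hypLevi, schwartzTransport_reindexCLE_leviS,
    schwartzTransport_reindexCLE_unitaryOpPi]

/-- the same on a vector given in the relabelled coordinates: `e_* (hypOp t (e_*⁻¹ g)) = μ₀((u^ε)⁻¹) (leviS δ^ε (μ₀(u^ε) g))`.
[cite: Folland1989, §4.2 (4.24), Prop. (4.39)] -/
theorem schwartzTransport_reindexCLE_hypOp_symm (ε : σ ≃ DPIdx P Q R S) (t : ℝ) (g : SchwartzMap (σ → ℝ) ℂ) :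
    schwartzTransport (reindexCLE ε) (hypOp R S p₀ q₀ t ((schwartzTransport (reindexCLE ε)).symm g)) =
      unitaryOpPi (reindexUnitary ε (frameU R S p₀ q₀))⁻¹
        (leviS (reindexLin ε (planeDil R S p₀ q₀ (Real.exp t) (Real.exp_pos t).ne'))
          (unitaryOpPi (reindexUnitary ε (frameU R S p₀ q₀)) g)) := by
  rw [schwartzTransport_reindexCLE_hypOp, ContinuousLinearEquiv.apply_symm_apply]

omit [Fintype σ] [DecidableEq σ] [Fintype P] [Fintype Q] [Fintype R] [DecidableEq R] [Fintype S] [DecidableEq S] in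
/-- the relabelled plane dilation is the diagonal dilation by `dilWt c ∘ ε`. [cite: Folland1989, §4.2 (4.24)] -/
theorem reindexLin_planeDil (ε : σ ≃ DPIdx P Q R S) (c : ℝ) (hc : c ≠ 0) :
    reindexLin ε (planeDil R S p₀ q₀ c hc) = diagEquiv (dilWt R S p₀ q₀ c ∘ ε) (fun k => dilWt_ne_zero R S p₀ q₀ hc (ε k)) :=
  reindexLin_diagEquiv ε _ _

end Hyp

section Step

variable {σ P Q : Type} (R S : Type) (p₀ : P) (q₀ : Q) [Unique R]

/-- the ladder step relabelled: `(β + e_k + e_{k′}) ∘ ε⁻¹ = β ∘ ε⁻¹ + d`, `k = ε⁻¹(p₀)`, `k′ = ε⁻¹(q₀)`, `d = sqStep`. [folklore] -/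
private theorem equivMapDomain_add_single_single (ε : σ ≃ DPIdx P Q R S) (β : σ →₀ ℕ) :
    (β + (Finsupp.single (ε.symm (idxP R S p₀ default)) 1 + Finsupp.single (ε.symm (idxQ R S q₀ default)) 1)).equivMapDomain ε =
      β.equivMapDomain ε + sqStep R S p₀ q₀ default := by
  ext j
  rw [Finsupp.equivMapDomain_apply, Finsupp.add_apply, Finsupp.add_apply, Finsupp.add_apply, Finsupp.equivMapDomain_apply, sqStep,
    Finsupp.add_apply, Finsupp.single_apply_left ε.symm.injective, Finsupp.single_apply_left ε.symm.injective]

/-- the lowering step relabelled: `(β − e_k − e_{k′}) ∘ ε⁻¹ = β ∘ ε⁻¹ − d`. [folklore] -/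
private theorem equivMapDomain_sub_single_single (ε : σ ≃ DPIdx P Q R S) (β : σ →₀ ℕ) :
    (β - (Finsupp.single (ε.symm (idxP R S p₀ default)) 1 + Finsupp.single (ε.symm (idxQ R S q₀ default)) 1)).equivMapDomain ε =
      β.equivMapDomain ε - sqStep R S p₀ q₀ default := by
  ext j
  rw [Finsupp.equivMapDomain_apply, Finsupp.tsub_apply, Finsupp.tsub_apply, Finsupp.add_apply, Finsupp.equivMapDomain_apply, sqStep,
    Finsupp.add_apply, Finsupp.single_apply_left ε.symm.injective, Finsupp.single_apply_left ε.symm.injective]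

end Step

section Ladder

variable {σ : Type} [Fintype σ] [DecidableEq σ] {P Q : Type} (R S : Type) [Fintype P] [DecidableEq P] [Fintype Q] [DecidableEq Q]
  [Fintype R] [DecidableEq R] [Fintype S] [DecidableEq S] [Unique R] [IsEmpty S] (p₀ : P) (q₀ : Q)

/-- **UP THE LADDER, in relabelled coordinates** (rank-one definite `W`): for every `β : σ →₀ ℕ` SOME boost moves `h_β` onto
`h_{β + e_k + e_{k′}}` (`k = ε⁻¹(p₀)`, `k′ = ε⁻¹(q₀)`) with a non-zero Hermite coefficient. [cite: Folland1989, §1.7 (1.82), §4.4 Thm. (4.37)]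
[cite: KashiwaraVergne1978, §6] -/
theorem exists_piCoeff_add_reindex_hypOp_hermitePi_ne_zero (ε : σ ≃ DPIdx P Q R S) (β : σ →₀ ℕ) :
    ∃ t : ℝ, piCoeff (β + (Finsupp.single (ε.symm (idxP R S p₀ default)) 1 + Finsupp.single (ε.symm (idxQ R S q₀ default)) 1))
      (schwartzTransport (reindexCLE ε) (hypOp R S p₀ q₀ t ((schwartzTransport (reindexCLE ε)).symm (hermitePi β)))) ≠ 0 := by
  obtain ⟨t, ht⟩ := exists_piCoeff_add_sqStep_hypOp_hermitePi_ne_zero R S p₀ q₀ (β.equivMapDomain ε)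
  refine ⟨t, ?_⟩
  rwa [piCoeff_schwartzTransport_reindexCLE, schwartzTransport_reindexCLE_symm_hermitePi, equivMapDomain_add_single_single]

/-- **DOWN THE LADDER, in relabelled coordinates** (`β_k, β_{k′} ≥ 1`). [cite: Folland1989, §1.7 (1.82), §4.4 Thm. (4.37)] [cite: KashiwaraVergne1978, §6] -/
theorem exists_piCoeff_sub_reindex_hypOp_hermitePi_ne_zero (ε : σ ≃ DPIdx P Q R S) (β : σ →₀ ℕ)
    (hk : 1 ≤ β (ε.symm (idxP R S p₀ default))) (hk' : 1 ≤ β (ε.symm (idxQ R S q₀ default))) :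
    ∃ t : ℝ, piCoeff (β - (Finsupp.single (ε.symm (idxP R S p₀ default)) 1 + Finsupp.single (ε.symm (idxQ R S q₀ default)) 1))
      (schwartzTransport (reindexCLE ε) (hypOp R S p₀ q₀ t ((schwartzTransport (reindexCLE ε)).symm (hermitePi β)))) ≠ 0 := by
  obtain ⟨t, ht⟩ := exists_piCoeff_sub_sqStep_hypOp_hermitePi_ne_zero R S p₀ q₀ (β.equivMapDomain ε)
    (by rw [Finsupp.equivMapDomain_apply]; exact hk) (by rw [Finsupp.equivMapDomain_apply]; exact hk')
  refine ⟨t, ?_⟩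
  rwa [piCoeff_schwartzTransport_reindexCLE, schwartzTransport_reindexCLE_symm_hermitePi, equivMapDomain_sub_single_single]

end Ladder

end RealDualPair

end Literature.RepresentationTheory.KonnoKonno2007

end
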